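import Summits.CriticalPhenomena.Ising3D.Control2DRhoExpansion
import Summits.CriticalPhenomena.Ising3D.Control2DOpeRateSharp
import Mathlib.Analysis.SpecialFunctions.Pow.Real
import Mathlib.Analysis.SpecialFunctions.Sqrt
import Mathlib.Analysis.SpecialFunctions.Log.Basic
import Mathlib.Tactic.Linarith
import Mathlib.Tactic.Positivity
import Mathlib.Tactic.FieldSimp
import Mathlib.Tactic.Ring
import Mathlib.Tactic.NormNum
import HarnessLib

/-!
# The sharp `ρ`-envelope of the chiral blocks and the rate with prefactor `E^{4s}`: what the `ρ`-expansion buys for the typed class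
(cell `pub-ising3x`, seat controls-1 gen 48; PAPER §6.2 / Appendix E — CONTROL-ONLY; companion of `Control2DRhoExpansion` and
`Control2DOpeRateSharp`)

HONEST FRAMING: lottery ticket; floor = tightest certified 3D Ising CFT bounds; no exact-solution
claim without a proof. CONTROL-ONLY (`d = 2`, global `sl(2) × sl(2)` blocks, `Δ_σ = s` an INPUT, axiom set `A2D′`);
nothing here is about `d = 3`, no certificate, functional or number of the record is touched, and no new hypothesis,
definition or named fact enters.

WHAT THIS FILE ADDS. `Control2DRhoExpansion` proved the `ρ`-series of the blocks, `k_{2h}(4ρ/(1+ρ)²) = (4ρ)^h ₂F₁(½,h;h+½;ρ²)`.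
Here are its consequences for the typed class, each replacing a hand-made constant of E.1x/E.1y by the true one:

* `rhoCoeff_eq_poch`, **`rhoCoeff_nonneg`**, `rhoCoeff_le` — the `ρ`-coefficients `b_n(h) = (½)_n (h)_n/(n!(h+½)_n)` (Mathlib's
  `ordinaryHypergeometricCoefficient (1/2) h (h+1/2) n`, no definition introduced) are `≥ 0` for `h ≥ 0` and `≤ (½)_n/n!`;
  **`hasSum_chiralBlock_rho`** — `k_{2h}(4ρ/(1+ρ)²) = Σ_n (4ρ)^h b_n(h) ρ^{2n}` with NON-NEGATIVE TERMS: the typed class's substitute for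
  the Hilbert-space positivity of the `ρ`-frame expansion (Pappadopulo–Rychkov–Espin–Rattazzi 2012 §5);
* **`chiralBlock_le_rho_sharp`** — `k_{2h}(4ρ/(1+ρ)²) ≤ (4ρ)^h/√(1-ρ²)` for `h ≥ 0`, `ρ ∈ (0,1)` (termwise domination by the binomial
  series of `(1-ρ²)^{-1/2}`), so with E.1x's `rpow_four_mul_le_chiralBlock` the h-FREE TWO-SIDED ENVELOPE
  `(4ρ)^h ≤ k_{2h} ≤ (4ρ)^h(1-ρ²)^{-1/2}` (E.1y's `chiralBlock_le_sharp`: `e(1+√h)(4ρ)^h/(1-ρ)²`);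
  **`globalBlock_diag_le_rho_sharp`** — `g_{Δ,ℓ}(z,z) ≤ 2(4ρ)^Δ/(1-ρ²)` for a unitary label (E.1y: `4e²(1+Δ)(4ρ)^Δ/(1-ρ)⁴`);
* **`CrossingData.tail_le_rho_sharp`** (+ `_rhoZ`, `_offDiag`) — for every unitary solution of the typed sum rule at `Δ_σ = s > 0`,
  every `ρ₀ ∈ (0,1)`, `E ≥ 3s` with `E·t > 4s` (`t = log(1/ρ₀)`), at `x₀ = 4ρ₀/(1+ρ₀)²`:
  `Σ'_{Δ_i ≥ E} p_i g_i(x₀,x₀) ≤ 2/(1-ρ₀²) · B · E^{4s} · ρ₀^E · Et/(Et - 4s)`, `B = ½e^{4s}16^s(5/(12s))^{4s}G(½,½)` — the sharp base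
  `ρ(x₀)` of E.1y now with Pappadopulo–Rychkov–Espin–Rattazzi's polynomial prefactor `E^{4Δ_φ} = E^{4s}` (E.1y: `E^{4s+1}`, `E ≥ 1`,
  `Et > 4s+1`, factor `8e²/(1-ρ₀)⁴`); record rows at `Δ_σ = 1/8` (`record_tail_le_rho_sharp`, `record_tail_le_rho_sharp_half`: at the
  crossing point, for every `E ≥ 3/8`, `≤ 2·(100/97)·(½e^{1/2}16^{1/8}(10/3)^{1/2}·7/3)·E^{1/2}·(1716/10⁴)^E·E log 5/(E log 5 - 1/2)`).

NOT claimed: the exact prefactor `16^s(1+2P₀)/Γ(4s+1)` and the Tauberian EQUALITY `F_ρ(E) ∼ 16^s(1+2P₀)E^{4s}/Γ(4s+1)` in the `ρ`-frame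
(the `ρ`-states series with non-negative weights is now available — `hasSum_chiralBlock_rho` — but the Karamata step is not run here);
any LOWER bound on a tail or on a single `p_i`; anything off the real diagonal beyond monotone domination; complex `z` / the cut plane;
Korevaar's logarithmic remainder; anything at `s = 0` (E.1q); Virasoro; anything three-dimensional; any bound on `Δ_ε`, `c` or `λ²`;
nothing of the record touched, no new hypothesis, definition or named fact. CONTEXT, not inputs: PRER 2012 §5.2, Hogervorst–Rychkov
2013; INPUTS = tree theorems by name (below).

References: D. Pappadopulo, S. Rychkov, J. Espin, R. Rattazzi, Phys. Rev. D 86 (2012) 105043, §5.2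
[cite: PappadopuloRychkovEspinRattazzi2012PRD, §5.2]; M. Hogervorst, S. Rychkov, Phys. Rev. D 87 (2013) 106004, §2
[cite: HogervorstRychkov2013, §2]. Tree: `chiralBlock_eq_rho` (`Control2DRhoExpansion`); `chiralBlock_nonneg` (`Control2DNonVacuity`);
`ascPochhammer_eval_eq_poch` (`Control2DGFFChiral`); `ascPochhammer_eval_nonneg` (`Control2DTermwise`); `poch`, `poch_pos`,
`hasSum_poch_div_factorial_mul_pow` (Literature `ConformalBootstrap3D.MeanFieldCoefficients` / `MeanFieldDecomposition`);
`poch_le_poch_of_le`, `four_mul_div_sq_mem_Ioo`, `rhoZ_mem_Ioo`, `four_mul_rhoZ_div_sq`, `rhoZ_half_lt` (`Control2DRhoCoordinate`);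
`sum_p_four_rpow_le_mul_rpow`, `summable_p_four_rpow_mul_exp` (`Control2DOpeDecay`); `tsum_ge_mul_exp_le_of_le_rpow`
(`Control2DAbelianTail`); `three_halves_lt_log_five` (`Control2DOpeRateSharp`); `record_fourPoint_half_le` (`Control2DConvergenceRate`);
`globalBlock_mono`, `opeConvergent_free`; `hasSum_ordinaryHypergeometric` (Literature `ZhouLegendreGreenValuesProofs`). Mathlib:
`hasSum_le`, `Real.sqrt_eq_rpow`, `Real.mul_self_sqrt`, `Real.rpow_def_of_pos`, `Real.log_le_log`, `Summable.tsum_le_tsum`.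
-/

namespace Summit.CriticalPhenomena.Ising3D.Control2D

open Set Filter Topology
open Literature.MathematicalPhysics.QuantumFieldTheory.ConformalBootstrap3D
open Literature.NumberTheory.Automorphic.LegendreP (hasSum_ordinaryHypergeometric)

/-! ### The `ρ`-coefficients `b_n(h) = (½)_n (h)_n / (n! (h+½)_n)`: non-negative, at most `(½)_n/n!` -/

/-- The `ρ`-coefficients in the tree's `poch` language: the `n`-th coefficient of `₂F₁(½,h;h+½;·)` is
`b_n(h) = (½)_n (h)_n / (n! (h+½)_n)`. [cite: HogervorstRychkov2013, §2] -/
theorem rhoCoeff_eq_poch (h : ℝ) (n : ℕ) :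
    ordinaryHypergeometricCoefficient (1 / 2 : ℝ) h (h + 1 / 2) n =
      poch (1 / 2) n * poch h n / ((n.factorial : ℝ) * poch (h + 1 / 2) n) := by
  simp only [ordinaryHypergeometricCoefficient, ascPochhammer_eval_eq_poch]
  ring

/-- **All `ρ`-coefficients are non-negative**: `b_n(h) ≥ 0` for `h ≥ 0` — the typed class's substitute for the Hilbert-space
positivity of the `ρ`-frame expansion in Pappadopulo–Rychkov–Espin–Rattazzi 2012 §5. [cite: PappadopuloRychkovEspinRattazzi2012PRD, §5.2] -/
theorem rhoCoeff_nonneg {h : ℝ} (hh : 0 ≤ h) (n : ℕ) :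
    0 ≤ ordinaryHypergeometricCoefficient (1 / 2 : ℝ) h (h + 1 / 2) n := by
  rw [rhoCoeff_eq_poch]
  have h1 : 0 < poch (1 / 2 : ℝ) n := poch_pos (by norm_num) n
  have h2 : 0 ≤ poch h n := by rw [← ascPochhammer_eval_eq_poch]; exact ascPochhammer_eval_nonneg n hh
  have h3 : 0 < poch (h + 1 / 2) n := poch_pos (by positivity) n
  positivity

/-- `b_n(h) ≤ (½)_n/n!` for `h ≥ 0` (`(h)_n ≤ (h+½)_n`): the `ρ`-series of `k_{2h}` is dominated termwise by the binomial series of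
`(1-ρ²)^{-1/2}`. [folklore] -/
theorem rhoCoeff_le {h : ℝ} (hh : 0 ≤ h) (n : ℕ) :
    ordinaryHypergeometricCoefficient (1 / 2 : ℝ) h (h + 1 / 2) n ≤ poch (1 / 2) n / (n.factorial : ℝ) := by
  rw [rhoCoeff_eq_poch]
  have h1 : 0 < poch (1 / 2 : ℝ) n := poch_pos (by norm_num) n
  have h3 : 0 < poch (h + 1 / 2) n := poch_pos (by positivity) n
  have hle : poch h n ≤ poch (h + 1 / 2) n := poch_le_poch_of_le hh (by linarith) n
  have hn : 0 < (n.factorial : ℝ) := by positivity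
  rw [div_le_div_iff₀ (by positivity) hn]
  calc poch (1 / 2) n * poch h n * (n.factorial : ℝ)
      ≤ poch (1 / 2) n * poch (h + 1 / 2) n * (n.factorial : ℝ) :=
        mul_le_mul_of_nonneg_right (mul_le_mul_of_nonneg_left hle h1.le) hn.le
    _ = poch (1 / 2) n / 1 * ((n.factorial : ℝ) * poch (h + 1 / 2) n) := by ring
    _ = _ := by rw [div_one]

/-! ### The `ρ`-series of the chiral block and the sharp two-sided envelope -/

/-- **The `ρ`-SERIES of the chiral block, with non-negative terms**: for `h ≥ 0` and `ρ ∈ (0,1)`,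
`k_{2h}(4ρ/(1+ρ)²) = Σ_n (4ρ)^h · b_n(h) · ρ^{2n}` as a `HasSum` (`chiralBlock_eq_rho` and the real `₂F₁` series of the tree), every term
`≥ 0` by `rhoCoeff_nonneg`. [cite: HogervorstRychkov2013, §2] -/
theorem hasSum_chiralBlock_rho {h : ℝ} (hh : 0 ≤ h) {ρ : ℝ} (hρ : ρ ∈ Ioo (0 : ℝ) 1) :
    HasSum (fun n : ℕ => (4 * ρ) ^ h * (ordinaryHypergeometricCoefficient (1 / 2 : ℝ) h (h + 1 / 2) n * (ρ ^ 2) ^ n))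
      (chiralBlock h (4 * ρ / (1 + ρ) ^ 2)) := by
  have habs : |ρ ^ 2| < 1 := by rw [abs_of_nonneg (sq_nonneg ρ)]; nlinarith [hρ.1, hρ.2]
  rw [chiralBlock_eq_rho hh hρ]
  exact (hasSum_ordinaryHypergeometric (1 / 2) h (h + 1 / 2) habs).mul_left _

/-- **The sharp upper envelope** (Hogervorst–Rychkov's constant): for `h ≥ 0` and `ρ ∈ (0,1)`,
`k_{2h}(4ρ/(1+ρ)²) ≤ (4ρ)^h / √(1-ρ²)` — termwise domination `b_n(h) ≤ (½)_n/n!` and the binomial series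
`Σ_n (½)_n/n! · x^n = (1-x)^{-1/2}` (`hasSum_poch_div_factorial_mul_pow`). With `Control2DRhoCoordinate.rpow_four_mul_le_chiralBlock`:
`(4ρ)^h ≤ k_{2h}(4ρ/(1+ρ)²) ≤ (4ρ)^h (1-ρ²)^{-1/2}`, the h-free two-sided envelope (E.1y: `e(1+√h)(4ρ)^h/(1-ρ)²`).
[cite: HogervorstRychkov2013, §2] -/
theorem chiralBlock_le_rho_sharp {h : ℝ} (hh : 0 ≤ h) {ρ : ℝ} (hρ : ρ ∈ Ioo (0 : ℝ) 1) :
    chiralBlock h (4 * ρ / (1 + ρ) ^ 2) ≤ (4 * ρ) ^ h / Real.sqrt (1 - ρ ^ 2) := by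
  have hx0 : 0 ≤ ρ ^ 2 := sq_nonneg ρ
  have hx1 : ρ ^ 2 < 1 := by nlinarith [hρ.1, hρ.2]
  have habs : |ρ ^ 2| < 1 := by rw [abs_of_nonneg hx0]; exact hx1
  have hF := hasSum_ordinaryHypergeometric (1 / 2) h (h + 1 / 2) habs
  have hB := hasSum_poch_div_factorial_mul_pow (1 / 2) habs
  have hle : ordinaryHypergeometric (1 / 2) h (h + 1 / 2) (ρ ^ 2) ≤ 1 / (1 - ρ ^ 2) ^ (1 / 2 : ℝ) :=
    hasSum_le (fun n => mul_le_mul_of_nonneg_right (rhoCoeff_le hh n) (pow_nonneg hx0 n)) hF hB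
  have hsqrt : (1 - ρ ^ 2) ^ (1 / 2 : ℝ) = Real.sqrt (1 - ρ ^ 2) := (Real.sqrt_eq_rpow (1 - ρ ^ 2)).symm
  rw [hsqrt] at hle
  have h4 : 0 ≤ (4 * ρ) ^ h := Real.rpow_nonneg (by linarith [hρ.1]) _
  rw [chiralBlock_eq_rho hh hρ]
  calc (4 * ρ) ^ h * ordinaryHypergeometric (1 / 2) h (h + 1 / 2) (ρ ^ 2)
      ≤ (4 * ρ) ^ h * (1 / Real.sqrt (1 - ρ ^ 2)) := mul_le_mul_of_nonneg_left hle h4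
    _ = _ := mul_one_div _ _

/-- **The symmetrised global block on the diagonal, sharp**: for a unitary label `ℓ ≤ Δ` and `ρ ∈ (0,1)`,
`g_{Δ,ℓ}(z,z) ≤ 2(4ρ)^Δ/(1-ρ²)` at `z = 4ρ/(1+ρ)²` (E.1x: `≥ 2(4ρ)^Δ`; E.1y: `≤ 4e²(1+Δ)(4ρ)^Δ/(1-ρ)⁴`). [folklore] -/
theorem globalBlock_diag_le_rho_sharp {Δ : ℝ} {ℓ : ℕ} (hΔ : (ℓ : ℝ) ≤ Δ) {ρ : ℝ} (hρ : ρ ∈ Ioo (0 : ℝ) 1) :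
    globalBlock Δ ℓ (4 * ρ / (1 + ρ) ^ 2) (4 * ρ / (1 + ρ) ^ 2) ≤ 2 * (4 * ρ) ^ Δ / (1 - ρ ^ 2) := by
  have hℓ : (0 : ℝ) ≤ ℓ := Nat.cast_nonneg ℓ
  have hh : 0 ≤ (Δ + ℓ) / 2 := by linarith
  have hhb : 0 ≤ (Δ - ℓ) / 2 := by linarith
  have hz := four_mul_div_sq_mem_Ioo hρ
  have hQ : 0 < 1 - ρ ^ 2 := by nlinarith [hρ.1, hρ.2]
  have h4ρ : 0 < 4 * ρ := by linarith [hρ.1]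
  have A := chiralBlock_le_rho_sharp hh hρ
  have B := chiralBlock_le_rho_sharp hhb hρ
  have hA0 : 0 ≤ chiralBlock ((Δ + ℓ) / 2) (4 * ρ / (1 + ρ) ^ 2) := chiralBlock_nonneg hh hz
  have hB0 : 0 ≤ chiralBlock ((Δ - ℓ) / 2) (4 * ρ / (1 + ρ) ^ 2) := chiralBlock_nonneg hhb hz
  have hsplit : (4 * ρ) ^ ((Δ + ℓ) / 2) * (4 * ρ) ^ ((Δ - ℓ) / 2) = (4 * ρ) ^ Δ := by
    rw [← Real.rpow_add h4ρ]; ring_nf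
  have hsq : Real.sqrt (1 - ρ ^ 2) * Real.sqrt (1 - ρ ^ 2) = 1 - ρ ^ 2 := Real.mul_self_sqrt hQ.le
  have hs0 : 0 < Real.sqrt (1 - ρ ^ 2) := Real.sqrt_pos.mpr hQ
  have hprod : chiralBlock ((Δ + ℓ) / 2) (4 * ρ / (1 + ρ) ^ 2) * chiralBlock ((Δ - ℓ) / 2) (4 * ρ / (1 + ρ) ^ 2) ≤
      ((4 * ρ) ^ ((Δ + ℓ) / 2) / Real.sqrt (1 - ρ ^ 2)) * ((4 * ρ) ^ ((Δ - ℓ) / 2) / Real.sqrt (1 - ρ ^ 2)) :=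
    mul_le_mul A B hB0 (hA0.trans A)
  have hXY : ((4 * ρ) ^ ((Δ + ℓ) / 2) / Real.sqrt (1 - ρ ^ 2)) * ((4 * ρ) ^ ((Δ - ℓ) / 2) / Real.sqrt (1 - ρ ^ 2)) =
      (4 * ρ) ^ Δ / (1 - ρ ^ 2) := by
    rw [div_mul_div_comm, hsplit, hsq]
  unfold globalBlock
  calc chiralBlock ((Δ + ℓ) / 2) (4 * ρ / (1 + ρ) ^ 2) * chiralBlock ((Δ - ℓ) / 2) (4 * ρ / (1 + ρ) ^ 2) +
        chiralBlock ((Δ - ℓ) / 2) (4 * ρ / (1 + ρ) ^ 2) * chiralBlock ((Δ + ℓ) / 2) (4 * ρ / (1 + ρ) ^ 2)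
      = 2 * (chiralBlock ((Δ + ℓ) / 2) (4 * ρ / (1 + ρ) ^ 2) * chiralBlock ((Δ - ℓ) / 2) (4 * ρ / (1 + ρ) ^ 2)) := by ring
    _ ≤ 2 * ((4 * ρ) ^ Δ / (1 - ρ ^ 2)) := by rw [← hXY]; nlinarith [hprod]
    _ = _ := by ring

namespace CrossingData

variable {D : CrossingData} {s : ℝ}

/-- **The rate with Pappadopulo–Rychkov–Espin–Rattazzi's prefactor `E^{4s}`**: for every unitary solution of the typed sum rule at
`Δ_σ = s > 0`, every `ρ₀ ∈ (0,1)` and every cut-off `E ≥ 3s` with `E·t > 4s`, `t = log(1/ρ₀)`, at `x₀ = 4ρ₀/(1+ρ₀)²`: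
`Σ'_{Δ_i ≥ E} p_i g_i(x₀,x₀) ≤ 2/(1-ρ₀²) · [½e^{4s}16^s(5/(12s))^{4s}G(½,½)] · E^{4s} · ρ₀^E · Et/(Et - 4s)` — termwise
`p_i g_i ≤ 2(1-ρ₀²)^{-1}·(p_i4^{Δ_i})·ρ₀^{Δ_i}` (`globalBlock_diag_le_rho_sharp`), then E.1w's Abelian lemma with exponent `4s` on E.1x's density
(`sum_p_four_rpow_le_mul_rpow`). E.1y (`tail_le_rhoPow`): prefactor `E^{4s+1}`, factor `8e²/(1-ρ₀)⁴`, `E ≥ 1`, `Et > 4s+1`.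
[cite: PappadopuloRychkovEspinRattazzi2012PRD, §5.2] -/
theorem tail_le_rho_sharp (hU : D.IsUnitary) (hC : D.SatisfiesCrossing s) (hs : 0 < s) {ρ₀ E : ℝ} (hρ₀ : ρ₀ ∈ Ioo (0 : ℝ) 1)
    (hE : 3 * s ≤ E) (hEt : 4 * s < E * Real.log (1 / ρ₀)) :
    ∑' i : ↥({i : D.ι | E ≤ D.Δ i} : Set D.ι),
        D.p i * globalBlock (D.Δ i) (D.spin i) (4 * ρ₀ / (1 + ρ₀) ^ 2) (4 * ρ₀ / (1 + ρ₀) ^ 2) ≤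
      2 / (1 - ρ₀ ^ 2) *
        (1 / 2 * Real.exp (4 * s) * (16 : ℝ) ^ s * (5 / (12 * s)) ^ (4 * s) * D.fourPoint (1 / 2) (1 / 2)) *
        E ^ (4 * s) * ρ₀ ^ E * (E * Real.log (1 / ρ₀) / (E * Real.log (1 / ρ₀) - 4 * s)) := by
  have hconv := opeConvergent_free hU hC hs
  have hz := four_mul_div_sq_mem_Ioo hρ₀
  have hE0 : 0 < E := by linarith
  have hQ : 0 < 1 - ρ₀ ^ 2 := by nlinarith [hρ₀.1, hρ₀.2]
  set x₀ : ℝ := 4 * ρ₀ / (1 + ρ₀) ^ 2 with hx₀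
  set t : ℝ := Real.log (1 / ρ₀) with htdef
  set T : Set D.ι := {i : D.ι | E ≤ D.Δ i} with hT
  set K : ℝ := 2 / (1 - ρ₀ ^ 2) with hK
  have hK0 : 0 ≤ K := by positivity
  have ht : 0 < t := Real.log_pos (by rw [lt_div_iff₀ hρ₀.1]; linarith [hρ₀.2])
  have hexp : ∀ y : ℝ, Real.exp (-(t * y)) = ρ₀ ^ y := by
    intro y
    rw [Real.rpow_def_of_pos hρ₀.1, htdef, one_div, Real.log_inv]; ring_nf
  -- E.1w's Abelian lemma on `w_i = p_i 4^{Δ_i}`, exponent `4s`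
  have hw : ∀ i, 0 ≤ D.p i * (4 : ℝ) ^ D.Δ i := fun i => mul_nonneg (hU i).2.2 (Real.rpow_nonneg (by norm_num) _)
  have hAbel := tsum_ge_mul_exp_le_of_le_rpow (w := fun i => D.p i * (4 : ℝ) ^ D.Δ i) (E := D.Δ) hw
    (fun t ht => summable_p_four_rpow_mul_exp hU hconv ht)
    (B := 1 / 2 * Real.exp (4 * s) * (16 : ℝ) ^ s * (5 / (12 * s)) ^ (4 * s) * D.fourPoint (1 / 2) (1 / 2))
    (ρ := 4 * s) (T := E) (t := t) (by linarith) hE0 ht (by linarith) (fun u hu => sum_p_four_rpow_le_mul_rpow hU hC hs hE hu)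
  -- termwise: `p_i g_i(x₀,x₀) ≤ K · w_i · e^{-tΔ_i}` on `T`
  have hWT : Summable fun i : ↥T => D.p i * (4 : ℝ) ^ D.Δ (i : D.ι) * Real.exp (-(t * D.Δ (i : D.ι))) :=
    (summable_p_four_rpow_mul_exp hU hconv ht).subtype T
  have hle : ∀ i : ↥T, D.p i * globalBlock (D.Δ (i : D.ι)) (D.spin (i : D.ι)) x₀ x₀ ≤
      K * (D.p i * (4 : ℝ) ^ D.Δ (i : D.ι) * Real.exp (-(t * D.Δ (i : D.ι)))) := by
    intro i
    have hg := globalBlock_diag_le_rho_sharp (hU i).2.1 hρ₀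
    have hp0 : 0 ≤ D.p i := (hU i).2.2
    have h4ρ : (4 * ρ₀) ^ D.Δ (i : D.ι) = (4 : ℝ) ^ D.Δ (i : D.ι) * ρ₀ ^ D.Δ (i : D.ι) := Real.mul_rpow (by norm_num) hρ₀.1.le
    rw [hexp, hK]
    rw [h4ρ] at hg
    calc D.p i * globalBlock (D.Δ (i : D.ι)) (D.spin (i : D.ι)) x₀ x₀
        ≤ D.p i * (2 * ((4 : ℝ) ^ D.Δ (i : D.ι) * ρ₀ ^ D.Δ (i : D.ι)) / (1 - ρ₀ ^ 2)) := mul_le_mul_of_nonneg_left hg hp0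
      _ = _ := by field_simp
  have hGT : Summable fun i : ↥T => D.p i * globalBlock (D.Δ (i : D.ι)) (D.spin (i : D.ι)) x₀ x₀ :=
    (hconv x₀ x₀ hz hz).subtype T
  have h1 : ∑' i : ↥T, D.p i * globalBlock (D.Δ (i : D.ι)) (D.spin (i : D.ι)) x₀ x₀ ≤
      K * ∑' i : ↥T, D.p i * (4 : ℝ) ^ D.Δ (i : D.ι) * Real.exp (-(t * D.Δ (i : D.ι))) := by
    rw [← tsum_mul_left]; exact hGT.tsum_le_tsum hle (hWT.mul_left K)
  have hmain := h1.trans (mul_le_mul_of_nonneg_left hAbel hK0)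
  rw [hexp E] at hmain
  refine hmain.trans (le_of_eq ?_)
  ring

/-- **The sharp rate at every diagonal point `x₀ ∈ (0,1)`**, with `ρ₀ = ρ(x₀) = (1-√(1-x₀))/(1+√(1-x₀))` written out
(`four_mul_rhoZ_div_sq`). [cite: PappadopuloRychkovEspinRattazzi2012PRD, §5.2] -/
theorem tail_le_rho_sharp_rhoZ (hU : D.IsUnitary) (hC : D.SatisfiesCrossing s) (hs : 0 < s) {x₀ E : ℝ}
    (hx₀ : x₀ ∈ Ioo (0 : ℝ) 1) (hE : 3 * s ≤ E)
    (hEt : 4 * s < E * Real.log (1 / ((1 - Real.sqrt (1 - x₀)) / (1 + Real.sqrt (1 - x₀))))) :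
    ∑' i : ↥({i : D.ι | E ≤ D.Δ i} : Set D.ι), D.p i * globalBlock (D.Δ i) (D.spin i) x₀ x₀ ≤
      2 / (1 - ((1 - Real.sqrt (1 - x₀)) / (1 + Real.sqrt (1 - x₀))) ^ 2) *
        (1 / 2 * Real.exp (4 * s) * (16 : ℝ) ^ s * (5 / (12 * s)) ^ (4 * s) * D.fourPoint (1 / 2) (1 / 2)) *
        E ^ (4 * s) * ((1 - Real.sqrt (1 - x₀)) / (1 + Real.sqrt (1 - x₀))) ^ E *
        (E * Real.log (1 / ((1 - Real.sqrt (1 - x₀)) / (1 + Real.sqrt (1 - x₀)))) /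
          (E * Real.log (1 / ((1 - Real.sqrt (1 - x₀)) / (1 + Real.sqrt (1 - x₀)))) - 4 * s)) := by
  have h := tail_le_rho_sharp hU hC hs (rhoZ_mem_Ioo hx₀) hE hEt
  rwa [four_mul_rhoZ_div_sq hx₀] at h

/-- **Off the diagonal**: for `0 < z, z̄ ≤ x₀ < 1` the tail at `(z,z̄)` is at most the tail at `(x₀,x₀)` (`globalBlock_mono`).
[cite: PappadopuloRychkovEspinRattazzi2012PRD, §5.2] -/
theorem tail_le_rho_sharp_offDiag (hU : D.IsUnitary) (hC : D.SatisfiesCrossing s) (hs : 0 < s) {z zb x₀ E : ℝ} (hz : 0 < z)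
    (hzb : 0 < zb) (hzx : z ≤ x₀) (hzbx : zb ≤ x₀) (hx₀1 : x₀ < 1) (hE : 3 * s ≤ E)
    (hEt : 4 * s < E * Real.log (1 / ((1 - Real.sqrt (1 - x₀)) / (1 + Real.sqrt (1 - x₀))))) :
    ∑' i : ↥({i : D.ι | E ≤ D.Δ i} : Set D.ι), D.p i * globalBlock (D.Δ i) (D.spin i) z zb ≤
      2 / (1 - ((1 - Real.sqrt (1 - x₀)) / (1 + Real.sqrt (1 - x₀))) ^ 2) *
        (1 / 2 * Real.exp (4 * s) * (16 : ℝ) ^ s * (5 / (12 * s)) ^ (4 * s) * D.fourPoint (1 / 2) (1 / 2)) *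
        E ^ (4 * s) * ((1 - Real.sqrt (1 - x₀)) / (1 + Real.sqrt (1 - x₀))) ^ E *
        (E * Real.log (1 / ((1 - Real.sqrt (1 - x₀)) / (1 + Real.sqrt (1 - x₀)))) /
          (E * Real.log (1 / ((1 - Real.sqrt (1 - x₀)) / (1 + Real.sqrt (1 - x₀)))) - 4 * s)) := by
  have hconv := opeConvergent_free hU hC hs
  have hx₀ : 0 < x₀ := lt_of_lt_of_le hz hzx
  have hzI : z ∈ Ioo (0 : ℝ) 1 := ⟨hz, lt_of_le_of_lt hzx hx₀1⟩
  have hzbI : zb ∈ Ioo (0 : ℝ) 1 := ⟨hzb, lt_of_le_of_lt hzbx hx₀1⟩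
  set T : Set D.ι := {i : D.ι | E ≤ D.Δ i} with hT
  have h1 : ∑' i : ↥T, D.p i * globalBlock (D.Δ i) (D.spin i) z zb ≤
      ∑' i : ↥T, D.p i * globalBlock (D.Δ i) (D.spin i) x₀ x₀ :=
    ((hconv z zb hzI hzbI).subtype T).tsum_le_tsum
      (fun i => mul_le_mul_of_nonneg_left (globalBlock_mono (hU i).2.1 hz hzb hzx hzbx hx₀1 hx₀1) (hU i).2.2)
      ((hconv x₀ x₀ ⟨hx₀, hx₀1⟩ ⟨hx₀, hx₀1⟩).subtype T)
  exact h1.trans (tail_le_rho_sharp_rhoZ hU hC hs ⟨hx₀, hx₀1⟩ hE hEt)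

end CrossingData

/-! ### The record's class at `Δ_σ = 1/8` -/

/-- **The rate for every datum of the record's class at `Δ_σ = 1/8`** (binders of E.1n's `record_sum_p_low_le`; `G(½,½) ≤ 7/3` by gen-44
`record_fourPoint_half_le`), `ρ₀`-parametrised: for every `ρ₀ ∈ (0,1)` and `E ≥ 3/8` with `E·log(1/ρ₀) > 1/2`, at `x₀ = 4ρ₀/(1+ρ₀)²`,
`Σ'_{Δ_i ≥ E} p_i g_i(x₀,x₀) ≤ 2/(1-ρ₀²) · (½e^{1/2}16^{1/8}(10/3)^{1/2}·7/3) · E^{1/2} · ρ₀^E · Et/(Et - 1/2)`, `t = log(1/ρ₀)` (E.1y: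
`8e²/(1-ρ₀)⁴ · (…) · E^{3/2} · ρ₀^E · Et/(Et - 3/2)`, `E ≥ 1`). CONTROL-ONLY; no certificate or number of the record is touched. [folklore] -/
theorem record_tail_le_rho_sharp (w : ℝ) (D : CrossingData) (hU : D.IsUnitary) (hC : D.SatisfiesCrossing (1 / 8))
    (hT : D.SpinTwoIn ({2} ∪ Ici (2 + 1))) (x : ℝ) (hwx : w ≤ x) (hS : D.ScalarsIn ({x} ∪ Ici 2)) {ρ₀ E : ℝ}
    (hρ₀ : ρ₀ ∈ Ioo (0 : ℝ) 1) (hE : 3 / 8 ≤ E) (hEt : 1 / 2 < E * Real.log (1 / ρ₀)) :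
    ∑' i : ↥({i : D.ι | E ≤ D.Δ i} : Set D.ι),
        D.p i * globalBlock (D.Δ i) (D.spin i) (4 * ρ₀ / (1 + ρ₀) ^ 2) (4 * ρ₀ / (1 + ρ₀) ^ 2) ≤
      2 / (1 - ρ₀ ^ 2) * (1 / 2 * Real.exp (1 / 2) * (16 : ℝ) ^ (1 / 8 : ℝ) * (10 / 3 : ℝ) ^ (1 / 2 : ℝ) * (7 / 3)) *
        E ^ (1 / 2 : ℝ) * ρ₀ ^ E * (E * Real.log (1 / ρ₀) / (E * Real.log (1 / ρ₀) - 1 / 2)) := by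
  have h := CrossingData.tail_le_rho_sharp hU hC (s := 1 / 8) (by norm_num) hρ₀ (E := E) (by linarith)
    (by rw [show 4 * (1 / 8 : ℝ) = 1 / 2 by norm_num]; exact hEt)
  have hG := record_fourPoint_half_le w D hU hC hT x hwx hS
  rw [show (4 * (1 / 8 : ℝ)) = 1 / 2 by norm_num, show (5 / (12 * (1 / 8 : ℝ))) = 10 / 3 by norm_num] at h
  have hQ : 0 < 1 - ρ₀ ^ 2 := by nlinarith [hρ₀.1, hρ₀.2]
  have hE0 : 0 < E := by linarith
  have ht : 0 < Real.log (1 / ρ₀) := Real.log_pos (by rw [lt_div_iff₀ hρ₀.1]; linarith [hρ₀.2])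
  have hL : 0 ≤ E * Real.log (1 / ρ₀) / (E * Real.log (1 / ρ₀) - 1 / 2) := div_nonneg (by positivity) (by linarith)
  have hR : 0 ≤ E ^ (1 / 2 : ℝ) * ρ₀ ^ E * (E * Real.log (1 / ρ₀) / (E * Real.log (1 / ρ₀) - 1 / 2)) :=
    mul_nonneg (mul_nonneg (Real.rpow_nonneg hE0.le _) (Real.rpow_nonneg hρ₀.1.le _)) hL
  have hKpos : 0 ≤ 2 / (1 - ρ₀ ^ 2) * (1 / 2 * Real.exp (1 / 2) * (16 : ℝ) ^ (1 / 8 : ℝ) * (10 / 3 : ℝ) ^ (1 / 2 : ℝ)) := by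
    positivity
  calc ∑' i : ↥({i : D.ι | E ≤ D.Δ i} : Set D.ι),
        D.p i * globalBlock (D.Δ i) (D.spin i) (4 * ρ₀ / (1 + ρ₀) ^ 2) (4 * ρ₀ / (1 + ρ₀) ^ 2)
      ≤ 2 / (1 - ρ₀ ^ 2) *
          (1 / 2 * Real.exp (1 / 2) * (16 : ℝ) ^ (1 / 8 : ℝ) * (10 / 3 : ℝ) ^ (1 / 2 : ℝ) * D.fourPoint (1 / 2) (1 / 2)) *
          E ^ (1 / 2 : ℝ) * ρ₀ ^ E * (E * Real.log (1 / ρ₀) / (E * Real.log (1 / ρ₀) - 1 / 2)) := h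
    _ = 2 / (1 - ρ₀ ^ 2) * (1 / 2 * Real.exp (1 / 2) * (16 : ℝ) ^ (1 / 8 : ℝ) * (10 / 3 : ℝ) ^ (1 / 2 : ℝ)) *
          D.fourPoint (1 / 2) (1 / 2) * (E ^ (1 / 2 : ℝ) * ρ₀ ^ E * (E * Real.log (1 / ρ₀) / (E * Real.log (1 / ρ₀) - 1 / 2))) := by
        ring
    _ ≤ 2 / (1 - ρ₀ ^ 2) * (1 / 2 * Real.exp (1 / 2) * (16 : ℝ) ^ (1 / 8 : ℝ) * (10 / 3 : ℝ) ^ (1 / 2 : ℝ)) *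
          (7 / 3) * (E ^ (1 / 2 : ℝ) * ρ₀ ^ E * (E * Real.log (1 / ρ₀) / (E * Real.log (1 / ρ₀) - 1 / 2))) :=
        mul_le_mul_of_nonneg_right (mul_le_mul_of_nonneg_left hG hKpos) hR
    _ = _ := by ring

/-- **The rate at the crossing point `x₀ = ½` for every datum of the record's class at `Δ_σ = 1/8`**, printed constants:
`ρ(½) = 3 - 2√2 < 1716/10⁴` (`rhoZ_half_lt`), so `ρ(½)^E ≤ (1716/10⁴)^E`, `1/(1-ρ(½)²) ≤ 100/97` (`(1716/10⁴)² < 3/100`), and the side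
condition is automatic for every `E ≥ 3/8`: `t = log(1/ρ(½)) ≥ log 5 > 3/2` (`three_halves_lt_log_five`) gives `E·t ≥ (3/8)(3/2) > 1/2 = 4s`,
while `Et/(Et - 1/2)` decreases in `t`: for every `E ≥ 3/8`,
`Σ'_{Δ_i ≥ E} p_i g_i(½,½) ≤ 2·(100/97) · (½e^{1/2}16^{1/8}(10/3)^{1/2}·7/3) · E^{1/2} · (1716/10⁴)^E · E·log 5/(E·log 5 - 1/2)` — against E.1y's
`8e²(10⁴/8284)⁴·(…)·E^{3/2}·(1716/10⁴)^E·E log 5/(E log 5 - 3/2)` for `E ≥ 1`. CONTROL-ONLY; no certificate or number of the record is touched. [folklore] -/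
theorem record_tail_le_rho_sharp_half (w : ℝ) (D : CrossingData) (hU : D.IsUnitary) (hC : D.SatisfiesCrossing (1 / 8))
    (hT : D.SpinTwoIn ({2} ∪ Ici (2 + 1))) (x : ℝ) (hwx : w ≤ x) (hS : D.ScalarsIn ({x} ∪ Ici 2)) {E : ℝ} (hE : 3 / 8 ≤ E) :
    ∑' i : ↥({i : D.ι | E ≤ D.Δ i} : Set D.ι), D.p i * globalBlock (D.Δ i) (D.spin i) (1 / 2) (1 / 2) ≤
      2 * ((100 : ℝ) / 97) * (1 / 2 * Real.exp (1 / 2) * (16 : ℝ) ^ (1 / 8 : ℝ) * (10 / 3 : ℝ) ^ (1 / 2 : ℝ) * (7 / 3)) *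
        E ^ (1 / 2 : ℝ) * ((1716 : ℝ) / 10000) ^ E * (E * Real.log 5 / (E * Real.log 5 - 1 / 2)) := by
  have hhalf : (1 / 2 : ℝ) ∈ Ioo (0 : ℝ) 1 := ⟨by norm_num, by norm_num⟩
  set ρ₀ : ℝ := (1 - Real.sqrt (1 - 1 / 2)) / (1 + Real.sqrt (1 - 1 / 2)) with hρ₀def
  have hρ₀ : ρ₀ ∈ Ioo (0 : ℝ) 1 := rhoZ_mem_Ioo hhalf
  have hρ₀lt : ρ₀ < 1716 / 10000 := rhoZ_half_lt
  have hz : 4 * ρ₀ / (1 + ρ₀) ^ 2 = 1 / 2 := four_mul_rhoZ_div_sq hhalf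
  have hlog5 := three_halves_lt_log_five
  -- `t = log(1/ρ₀) ≥ log 5 > 3/2`, so `E·t > 1/2` for `E ≥ 3/8`
  have hinv : (5 : ℝ) ≤ 1 / ρ₀ := by rw [le_div_iff₀ hρ₀.1]; linarith
  have ht5 : Real.log 5 ≤ Real.log (1 / ρ₀) := Real.log_le_log (by norm_num) hinv
  have hE0 : 0 < E := by linarith
  have hEt5 : 1 / 2 < E * Real.log 5 := by nlinarith
  have hEt : 1 / 2 < E * Real.log (1 / ρ₀) := by nlinarith
  have h := record_tail_le_rho_sharp w D hU hC hT x hwx hS hρ₀ hE hEt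
  rw [hz] at h
  -- bound the `ρ₀`-dependent factors by their printed values
  set B : ℝ := 1 / 2 * Real.exp (1 / 2) * (16 : ℝ) ^ (1 / 8 : ℝ) * (10 / 3 : ℝ) ^ (1 / 2 : ℝ) * (7 / 3) with hB
  have hB0 : 0 ≤ B := by positivity
  have hQ : 0 < 1 - ρ₀ ^ 2 := by nlinarith [hρ₀.1, hρ₀.2]
  have h1 : 2 / (1 - ρ₀ ^ 2) ≤ 2 * ((100 : ℝ) / 97) := by
    rw [div_le_iff₀ hQ]
    nlinarith [hρ₀.1]
  have h2 : ρ₀ ^ E ≤ ((1716 : ℝ) / 10000) ^ E := Real.rpow_le_rpow hρ₀.1.le hρ₀lt.le hE0.le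
  have h3 : E * Real.log (1 / ρ₀) / (E * Real.log (1 / ρ₀) - 1 / 2) ≤ E * Real.log 5 / (E * Real.log 5 - 1 / 2) := by
    rw [div_le_div_iff₀ (by linarith) (by linarith)]
    nlinarith [mul_le_mul_of_nonneg_left ht5 hE0.le]
  have hE12 : 0 ≤ E ^ (1 / 2 : ℝ) := Real.rpow_nonneg hE0.le _
  have hρE : 0 ≤ ρ₀ ^ E := Real.rpow_nonneg hρ₀.1.le _
  have hL0 : 0 ≤ E * Real.log (1 / ρ₀) / (E * Real.log (1 / ρ₀) - 1 / 2) := div_nonneg (by nlinarith) (by linarith)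
  calc ∑' i : ↥({i : D.ι | E ≤ D.Δ i} : Set D.ι), D.p i * globalBlock (D.Δ i) (D.spin i) (1 / 2) (1 / 2)
      ≤ 2 / (1 - ρ₀ ^ 2) * B * E ^ (1 / 2 : ℝ) * ρ₀ ^ E * (E * Real.log (1 / ρ₀) / (E * Real.log (1 / ρ₀) - 1 / 2)) := h
    _ ≤ 2 * ((100 : ℝ) / 97) * B * E ^ (1 / 2 : ℝ) * ((1716 : ℝ) / 10000) ^ E * (E * Real.log 5 / (E * Real.log 5 - 1 / 2)) := by
        have hA : 2 / (1 - ρ₀ ^ 2) * B * E ^ (1 / 2 : ℝ) ≤ 2 * ((100 : ℝ) / 97) * B * E ^ (1 / 2 : ℝ) :=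
          mul_le_mul_of_nonneg_right (mul_le_mul_of_nonneg_right h1 hB0) hE12
        have hA0 : 0 ≤ 2 * ((100 : ℝ) / 97) * B * E ^ (1 / 2 : ℝ) := by positivity
        exact mul_le_mul (mul_le_mul hA h2 hρE hA0) h3 hL0 (mul_nonneg hA0 (Real.rpow_nonneg (by norm_num) _))

end Summit.CriticalPhenomena.Ising3D.Control2D
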